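import Mathlib
import HarnessLib
import Summits.Ventures.LatticeQCDFlow.Exactness.SUNResidualFlowGenerator
import Summits.Ventures.LatticeQCDFlow.Exactness.SUNResidualLayerEquiv
import Summits.Ventures.LatticeQCDFlow.Exactness.FlowPushforward
import Summits.Ventures.LatticeQCDFlow.TrivializingMaps.FlowPushforwardDensity
import Summits.Ventures.LatticeQCDFlow.TrivializingMaps.SuBasisExistence
import Literature.MathematicalPhysics.QuantumFieldTheory.Luscher2010.FlowExistenceProofs

/-!
# The masked `SU(N)` residual / stout coupling layer is EXACT for product Haar, for every `N`: a `HasJacobian` certificate with a continuous positive Jacobian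

HONEST FRAMING: exact (Metropolis-corrected) sampling algorithms for lattice gauge theory;
figures of merit are autocorrelation/cost numbers at stated couplings and volumes; no
continuum-physics claim.

Venture `LatticeQCDFlow` (cell pub-lqcd), topic `Exactness`; FANOUT row 10 (`eng-equiv`, engine
`latflow.equiv` / `latflow.flows_jax`: `equiv/residual.py` — `ResidualCoupling`, stout / stout-defect /
plaquette-potential layers with the BIJECTIVITY GUARD `κ < 1` — and `flows_jax/residual_flow.py`, the
trainable stout-class flow with `κ < 1` by construction).  NEW WORK of the cell, file 5 of the series
(`SUNResidualLayerVelocity`, `SUNResidualIsotopy`, `SUNResidualTangentOperator`,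
`SUNResidualFlowGenerator`): the one item of row 10's charter that was not typed — the residual
layer's Jacobian for `N ≥ 3` (LEANMAP-eng-equiv §C‴: "needs the Haar volume form of `SU(n)` as a Lie
group — not in Mathlib").  It needs no volume form: row 31's PROVED Jacobian formula of Lüscher
(`TrivializingMaps.JacobianFormula`, eq. (3.9) of CMP 293 (2010) 899, by transport and Haar
integration by parts) pushes product Haar through the flow of ANY jointly `C¹` tangent generator
with a continuous positive density (`TrivializingMaps.exists_flowMap_pushforward_density`), and the
INVERSE of the residual layer is such a flow (`SUNResidualFlowGenerator`).

* `coeConfig_sunResidualLayer` — the engine's masked residual layer of `SUNResidualLayerEquiv`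
  (`Theory2.coupleFun` of the fibres `u ↦ e^{Q a y u} u`) read ambiently is the isotopy at `τ = 1`;
* **`residualIsotopy_flowMap_eq`** — THE INVERSION: for the generator `Z` of
  `exists_residualIsotopy_generator` and its global flow `Φ` (`Luscher2010.FlowExistence.flowMap`,
  row 31), `famb[σ s] (Φ_s V) = V` for all real `s` and all `V ∈ SU(n)^E` — differentiate in `s`: the
  isotopy's own velocity `σ′ Q · famb` on an active link is cancelled by the transported velocity
  `D_W famb · (Z_s Φ_s) Φ_s` (the cancellation identity, the mask axiom
  `fderiv_residualIsotopy_single_of_ne`, and frozen links do not move); a function with zero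
  derivative is constant, and at `s = 0` both sides are `V`.  No inverse-function theorem is used;
* **`hasJacobian_sunResidualLayer`** — THE CERTIFICATE: for every `d`, `L ≥ 1`, `n`, every mask `p`,
  every family of exponents satisfying the engine's guard (`Q a y : SU(n) → 𝔰𝔲(n)`,
  `κ a y`-Lipschitz in the Frobenius norm, `0 ≤ κ a y < 1`) that is realised by `C²` ambient
  exponents (`Qamb a (coe U) = Q a y (U a)` — every polynomial loop-sum exponent of the engine is),
  there is a CONTINUOUS, STRICTLY POSITIVE `J` with
  `HasJacobian (⊗_e Haar_{SU(n)}) (masked residual layer) (ofReal ∘ J)`, i.e.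
  `layer_* (J · ⊗Haar) = ⊗Haar` — the hypothesis of `FlowPushforward.wilson_flow_reweighting_exact`,
  `HasJacobian.map_withDensity_equiv` (with `exists_measurableEquiv_sunResidualLayer`), the flow-MCMC
  and FT-HMC exactness theorems, for the residual / stout layers and EVERY `N`.  `J` is Liouville's
  `exp(−∫₀¹ div Z_s ∘ Φ_s ds)` along the inverse isotopy (the formula of
  `exists_flowMap_pushforward_density`); that it coincides with the engine's closed-form per-link
  determinant `|det(1 + ∂(e^{Q}·)…)|` is NOT claimed here — but `HasJacobian.jac_ae_eq`: any two exact
  Jacobians of the same automorphism agree almost everywhere, so a closed form that IS exact equals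
  `J` a.e.

Printed counterparts, NAMED ONLY: M. Lüscher, CMP 293 (2010) 899, §3 eqs. (3.2)–(3.9); Abbott et
al., arXiv:2305.02402 §4.2 (residual layers); Morningstar–Peardon, PRD 69 (2004) 054501.
-/

noncomputable section

namespace Summit.Ventures.LatticeQCDFlow.Exactness

open Literature.MathematicalPhysics.QuantumFieldTheory
open Literature.MathematicalPhysics.QuantumFieldTheory.Luscher2010
open Literature.MathematicalPhysics.QuantumFieldTheory.WilsonFlow
open Summit.Ventures.LatticeQCDFlow.TrivializingMaps
open MeasureTheory Filter Set
open scoped Matrix Matrix.Norms.Frobenius Topology ContDiff ENNReal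

variable {d L n : ℕ} [NeZero L]

section Layer

variable (p : Edge d L → Prop) [DecidablePred p]
  (Q : {e : Edge d L // p e} → ({f : Edge d L // ¬p f} → Matrix.specialUnitaryGroup (Fin n) ℂ) →
    Matrix (Fin n) (Fin n) ℂ → Matrix (Fin n) (Fin n) ℂ)
  (κ : {e : Edge d L // p e} → ({f : Edge d L // ¬p f} → Matrix.specialUnitaryGroup (Fin n) ℂ) → ℝ)
  (Qamb : {e : Edge d L // p e} → AmbConfig d L n → Matrix (Fin n) (Fin n) ℂ)

set_option quotPrecheck false in
/-- The residual isotopy at time `τ` (local notation, as in `SUNResidualIsotopy`). -/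
local notation "famb[" τ "]" => (fun (W : AmbConfig d L n) (e : Edge d L) =>
  if h : p e then NormedSpace.exp ((τ : ℝ) • Qamb ⟨e, h⟩ W) * W e else W e)

omit [NeZero L] in
/-- **The engine's masked residual layer, read ambiently, is the isotopy at `τ = 1`.** -/
theorem coeConfig_sunResidualLayer
    (hQ : ∀ a y, ∀ U ∈ Matrix.specialUnitaryGroup (Fin n) ℂ, (Q a y U)ᴴ = -Q a y U ∧ (Q a y U).trace = 0)
    (hQambQ : ∀ a (U : GaugeConfig d L (Matrix.specialUnitaryGroup (Fin n) ℂ)),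
      Qamb a (coeConfig U) = Q a (fun f => U f) (U a.1 : Matrix (Fin n) (Fin n) ℂ))
    (U : GaugeConfig d L (Matrix.specialUnitaryGroup (Fin n) ℂ)) :
    coeConfig (Theory2.coupleFun p (fun a y (u : Matrix.specialUnitaryGroup (Fin n) ℂ) =>
      (⟨NormedSpace.exp (Q a y u) * u, residual_value_mem (hQ a y) u.2⟩ :
        Matrix.specialUnitaryGroup (Fin n) ℂ)) U) = (famb[(1 : ℝ)]) (coeConfig U) := by
  funext e
  by_cases he : p e
  · rw [coeConfig_apply, Theory2.coupleFun_apply_of_pos _ _ he]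
    simp only [he, ↓reduceDIte, one_smul, coeConfig_apply]
    rw [hQambQ ⟨e, he⟩]
  · rw [coeConfig_apply, Theory2.coupleFun_apply_of_neg _ _ he]
    simp only [he, ↓reduceDIte, coeConfig_apply]

/-! ## The flow of the generator inverts the isotopy -/

/-- **Inversion along the flow.**  Let `Z` be a jointly `C¹` tangent generator, zero on frozen
links, satisfying the cancellation identity of `exists_residualIsotopy_generator`, and let `Φ` be
its global flow on `SU(n)^E` (row 31).  Then `famb[σ s] (Φ_s V) = V` for every real `s`:
`d/ds famb[σ s](Φ_s V) = σ′(s) Q famb + D_W famb · (Z_s Φ_s) Φ_s = 0` link by link, and both sides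
agree at `s = 0`. -/
theorem residualIsotopy_flowMap_eq (hQ2 : ∀ a, ContDiff ℝ 2 (Qamb a))
    (hQambQ : ∀ a (U : GaugeConfig d L (Matrix.specialUnitaryGroup (Fin n) ℂ)),
      Qamb a (coeConfig U) = Q a (fun f => U f) (U a.1 : Matrix (Fin n) (Fin n) ℂ))
    {Z : ℝ → AmbConfig d L n → AmbConfig d L n}
    (hZ1 : ContDiff ℝ 1 (fun q : ℝ × AmbConfig d L n => Z q.1 q.2))
    (hZt : Generator.IsTangent Z)
    (hZ0 : ∀ (s : ℝ) (W : AmbConfig d L n) (e : Edge d L), ¬p e → Z s W e = 0)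
    (hZid : ∀ (s : ℝ) (U : GaugeConfig d L (Matrix.specialUnitaryGroup (Fin n) ℂ)) (a : Edge d L)
      (ha : p a), fderiv ℝ (famb[(1 - Real.cos (Real.pi * s)) / 2]) (coeConfig U)
          (Pi.single a (Z s (coeConfig U) a * (U a : Matrix (Fin n) (Fin n) ℂ))) a =
        -((Real.pi / 2 * Real.sin (Real.pi * s)) • (Qamb ⟨a, ha⟩ (coeConfig U) *
          (NormedSpace.exp (((1 - Real.cos (Real.pi * s)) / 2) • Qamb ⟨a, ha⟩ (coeConfig U)) *
            (U a : Matrix (Fin n) (Fin n) ℂ)))))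
    (s : ℝ) (V : GaugeConfig d L (Matrix.specialUnitaryGroup (Fin n) ℂ)) :
    (famb[(1 - Real.cos (Real.pi * s)) / 2]) (coeConfig (FlowExistence.flowMap hZ1 s V)) = coeConfig V := by
  -- the reparametrisation and its derivative
  obtain ⟨σ, hσ⟩ : ∃ σ : ℝ → ℝ, σ = fun s => (1 - Real.cos (Real.pi * s)) / 2 := ⟨_, rfl⟩
  obtain ⟨σ', hσ'⟩ : ∃ σ' : ℝ → ℝ, σ' = fun s => Real.pi / 2 * Real.sin (Real.pi * s) := ⟨_, rfl⟩
  have hσd : ∀ s, HasDerivAt σ (σ' s) s := by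
    intro s
    rw [hσ, hσ']
    show HasDerivAt (fun s : ℝ => (1 - Real.cos (Real.pi * s)) / 2) (Real.pi / 2 * Real.sin (Real.pi * s)) s
    have h1 : HasDerivAt (fun s : ℝ => Real.pi * s) Real.pi s := by
      simpa using (hasDerivAt_id s).const_mul Real.pi
    have h2 := (h1.cos.const_sub 1).div_const 2
    exact h2.congr_deriv (by ring)
  have hσC : ContDiff ℝ 2 σ := by
    rw [hσ]
    exact (contDiff_const.sub (Real.contDiff_cos.comp (contDiff_const.mul contDiff_id))).div_const _
  -- the flow and its velocity
  have hΦ := FlowExistence.isFlowMap_flowMap hZ1 hZt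
  obtain ⟨W, hW⟩ : ∃ W : ℝ → AmbConfig d L n, W = fun s => coeConfig (FlowExistence.flowMap hZ1 s V) :=
    ⟨_, rfl⟩
  have hWd : ∀ s, HasDerivAt W (FlowExistence.vf₀ Z s (W s)) s := by
    intro s
    rw [hW]
    exact FlowExistence.hasDerivAt_of_isFlowLine (hΦ.2 V) s
  -- the uncurried isotopy and its derivative along `s ↦ (σ s, W s)`
  have hG2 : ContDiff ℝ 2 (fun q : ℝ × AmbConfig d L n => (famb[q.1]) q.2) :=
    contDiff_residualIsotopy p Qamb hQ2
  have hGd : ∀ q : ℝ × AmbConfig d L n, HasFDerivAt (fun q : ℝ × AmbConfig d L n => (famb[q.1]) q.2)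
      (fderiv ℝ (fun q : ℝ × AmbConfig d L n => (famb[q.1]) q.2) q) q := fun q =>
    ((hG2.differentiable (by norm_num)).differentiableAt).hasFDerivAt
  have hderiv : ∀ s, HasDerivAt (fun s => (famb[σ s]) (W s))
      (fderiv ℝ (fun q : ℝ × AmbConfig d L n => (famb[q.1]) q.2) (σ s, W s) (σ' s, FlowExistence.vf₀ Z s (W s)))
      s := fun s =>
    HasFDerivAt.comp_hasDerivAt (l := fun q : ℝ × AmbConfig d L n => (famb[q.1]) q.2)
      (f := fun s => (σ s, W s)) s (hGd (σ s, W s)) ((hσd s).prodMk (hWd s))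
  -- the two partial derivatives of the uncurried isotopy
  have hDτ : ∀ (τ : ℝ) (W₀ : AmbConfig d L n),
      fderiv ℝ (fun q : ℝ × AmbConfig d L n => (famb[q.1]) q.2) (τ, W₀) ((1 : ℝ), (0 : AmbConfig d L n)) =
        fun e => if h : p e then Qamb ⟨e, h⟩ W₀ * (famb[τ]) W₀ e else 0 := by
    intro τ W₀
    have h1 : HasDerivAt (fun τ' : ℝ => (famb[τ']) W₀)
        (fderiv ℝ (fun q : ℝ × AmbConfig d L n => (famb[q.1]) q.2) (τ, W₀) ((1 : ℝ), (0 : AmbConfig d L n))) τ :=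
      HasFDerivAt.comp_hasDerivAt (l := fun q : ℝ × AmbConfig d L n => (famb[q.1]) q.2)
        (f := fun τ' : ℝ => (τ', W₀)) τ (hGd (τ, W₀)) ((hasDerivAt_id τ).prodMk (hasDerivAt_const τ W₀))
    exact h1.unique (hasDerivAt_residualIsotopy_tau p Qamb W₀ τ)
  have hDW : ∀ (τ : ℝ) (W₀ V₀ : AmbConfig d L n),
      fderiv ℝ (fun q : ℝ × AmbConfig d L n => (famb[q.1]) q.2) (τ, W₀) ((0 : ℝ), V₀) =
        fderiv ℝ (famb[τ]) W₀ V₀ := by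
    intro τ W₀ V₀
    have h1 : HasFDerivAt (famb[τ])
        ((fderiv ℝ (fun q : ℝ × AmbConfig d L n => (famb[q.1]) q.2) (τ, W₀)).comp
          (ContinuousLinearMap.inr ℝ ℝ (AmbConfig d L n))) W₀ :=
      (hGd (τ, W₀)).comp W₀ (hasFDerivAt_prodMk_right τ W₀)
    rw [h1.fderiv]
    rfl
  -- the derivative vanishes
  have hzero : ∀ s, HasDerivAt (fun s => (famb[σ s]) (W s)) (0 : AmbConfig d L n) s := by
    intro s
    have hWs : W s = coeConfig (FlowExistence.flowMap hZ1 s V) := by rw [hW]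
    set U := FlowExistence.flowMap hZ1 s V with hU
    have hsplit : ((σ' s, FlowExistence.vf₀ Z s (W s)) : ℝ × AmbConfig d L n) =
        σ' s • ((1 : ℝ), (0 : AmbConfig d L n)) + ((0 : ℝ), FlowExistence.vf₀ Z s (W s)) := by
      rw [Prod.smul_mk, smul_eq_mul, mul_one, smul_zero, Prod.mk_add_mk, add_zero, zero_add]
    have hval : fderiv ℝ (fun q : ℝ × AmbConfig d L n => (famb[q.1]) q.2) (σ s, W s)
        (σ' s, FlowExistence.vf₀ Z s (W s)) = 0 := by
      rw [hsplit, map_add, map_smul, hDτ, hDW]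
      -- the velocity as a sum of single-link directions
      have hvf : FlowExistence.vf₀ Z s (W s) = ∑ b : Edge d L, Pi.single b (Z s (W s) b * W s b) := by
        rw [Finset.univ_sum_single]
        rfl
      rw [hvf, map_sum]
      funext e
      rw [Pi.add_apply, Pi.smul_apply, Finset.sum_apply, Pi.zero_apply]
      by_cases he : p e
      · -- active link: the isotopy's own velocity is cancelled by the transported one
        simp only [he, ↓reduceDIte]
        have hsum : ∑ b : Edge d L, fderiv ℝ (famb[σ s]) (W s) (Pi.single b (Z s (W s) b * W s b)) e =
            fderiv ℝ (famb[σ s]) (W s) (Pi.single e (Z s (W s) e * W s e)) e := by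
          refine Finset.sum_eq_single e (fun b _ hb => ?_) (fun h => absurd (Finset.mem_univ e) h)
          by_cases hb' : p b
          · obtain ⟨hb1, hb2⟩ := (mem_suAlgebra_iff _).1 (hZt s U b)
            rw [hWs, coeConfig_apply]
            exact fderiv_residualIsotopy_single_of_ne p Q Qamb hQ2 hQambQ (σ s) U hb' hb1 hb2 hb.symm
          · rw [hZ0 s (W s) b hb', zero_mul, Pi.single_zero, map_zero, Pi.zero_apply]
        rw [hsum, hWs, coeConfig_apply]
        have hid := hZid s U e he
        have hσs : (1 - Real.cos (Real.pi * s)) / 2 = σ s := by rw [hσ]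
        have hσ's : Real.pi / 2 * Real.sin (Real.pi * s) = σ' s := by rw [hσ']
        rw [hσs, hσ's] at hid
        rw [hid, add_neg_eq_zero]
      · -- frozen link: nothing moves
        simp only [he, ↓reduceDIte, smul_zero, zero_add]
        have hsum : ∑ b : Edge d L, fderiv ℝ (famb[σ s]) (W s) (Pi.single b (Z s (W s) b * W s b)) e = 0 := by
          refine Finset.sum_eq_zero fun b _ => ?_
          rw [fderiv_residualIsotopy_apply_of_not p Qamb hQ2 (σ s) (W s) _ he]
          by_cases hb : b = e
          · subst hb
            rw [Pi.single_eq_same, hZ0 s (W s) b he, zero_mul]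
          · exact Pi.single_eq_of_ne (Ne.symm hb) _
        rw [hsum]
    have h := hderiv s
    rwa [hval] at h
  -- hence the function is constant, equal to its value at `s = 0`
  have hconst := is_const_of_deriv_eq_zero (fun s => (hzero s).differentiableAt) (fun s => (hzero s).deriv) s 0
  have hσs : (1 - Real.cos (Real.pi * s)) / 2 = σ s := by rw [hσ]
  have hσ0 : σ 0 = 0 := by rw [hσ]; simp
  have hW0 : W 0 = coeConfig V := by rw [hW]; exact congrArg coeConfig (hΦ.1 V)
  have hWs : coeConfig (FlowExistence.flowMap hZ1 s V) = W s := by rw [hW]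
  rw [hσs, hWs]
  change (fun s => (famb[σ s]) (W s)) s = coeConfig V
  rw [hconst]
  change (famb[σ 0]) (W 0) = coeConfig V
  rw [hσ0, hW0]
  exact residualIsotopy_zero p Qamb (coeConfig V)

/-! ## The certificate -/

/-- **The masked `SU(N)` residual / stout layer is exact for product Haar, for every `N`.**  Under
the engine's guard (exponents `Q a y : SU(n) → 𝔰𝔲(n)` read from the frozen links, `κ a y`-Lipschitz
in the Frobenius norm with `0 ≤ κ a y < 1`), realised by `C²` ambient exponents `Qamb`, there is a
continuous, strictly positive `J` with `HasJacobian (⊗_e Haar_{SU(n)}) layer (ofReal ∘ J)`: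
`layer_* (J · ⊗Haar) = ⊗Haar`.  Proof: the flow `Φ` of the generator of
`exists_residualIsotopy_generator` satisfies `layer ∘ Φ_1 = id` (`residualIsotopy_flowMap_eq` at
`s = 1`, where `σ 1 = 1`), and `(Φ_1)_* ⊗Haar = q · ⊗Haar` with `q` continuous and positive by
Lüscher's Jacobian formula (`exists_flowMap_pushforward_density`); take `J = q`. -/
theorem hasJacobian_sunResidualLayer
    (hQ : ∀ a y, ∀ U ∈ Matrix.specialUnitaryGroup (Fin n) ℂ, (Q a y U)ᴴ = -Q a y U ∧ (Q a y U).trace = 0)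
    (hlip : ∀ a y, ∀ U ∈ Matrix.specialUnitaryGroup (Fin n) ℂ, ∀ V ∈ Matrix.specialUnitaryGroup (Fin n) ℂ,
      frobNorm (Q a y U - Q a y V) ≤ κ a y * frobNorm (U - V))
    (hκ0 : ∀ a y, 0 ≤ κ a y) (hκ : ∀ a y, κ a y < 1)
    (hQ2 : ∀ a, ContDiff ℝ 2 (Qamb a))
    (hQambQ : ∀ a (U : GaugeConfig d L (Matrix.specialUnitaryGroup (Fin n) ℂ)),
      Qamb a (coeConfig U) = Q a (fun f => U f) (U a.1 : Matrix (Fin n) (Fin n) ℂ)) :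
    ∃ J : GaugeConfig d L (Matrix.specialUnitaryGroup (Fin n) ℂ) → ℝ,
      Continuous J ∧ (∀ U, 0 < J U) ∧
      HasJacobian (Measure.pi fun _ : Edge d L => haarProbability (Matrix.specialUnitaryGroup (Fin n) ℂ))
        (Theory2.coupleFun p (fun a y (u : Matrix.specialUnitaryGroup (Fin n) ℂ) =>
          (⟨NormedSpace.exp (Q a y u) * u, residual_value_mem (hQ a y) u.2⟩ :
            Matrix.specialUnitaryGroup (Fin n) ℂ)))
        (fun U => ENNReal.ofReal (J U)) := by
  haveI : SecondCountableTopology (Matrix (Fin n) (Fin n) ℂ) :=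
    inferInstanceAs (SecondCountableTopology (Fin n → Fin n → ℂ))
  haveI : SecondCountableTopology (Matrix.specialUnitaryGroup (Fin n) ℂ) :=
    Topology.IsEmbedding.subtypeVal.secondCountableTopology
  -- the generator and its flow
  obtain ⟨Z, hZ1, hZsu, hZ0, hZid⟩ :=
    exists_residualIsotopy_generator p Q κ Qamb hQ2 hQ hlip hκ0 hκ hQambQ
  have hZt : Generator.IsTangent Z := fun t U e => (mem_suAlgebra_iff _).2 (hZsu t U e)
  have hΦ := FlowExistence.isFlowMap_flowMap hZ1 hZt
  -- Lüscher's Jacobian formula: the flow at time 1 pushes product Haar to a continuous positive density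
  obtain ⟨q, hqc, hq0, -, hmap⟩ := exists_flowMap_pushforward_density (SuBasisExistence.stdSuBasis n)
    hZ1 hZt hΦ 1
  -- the layer inverts the flow at time 1
  set F := Theory2.coupleFun p (fun a y (u : Matrix.specialUnitaryGroup (Fin n) ℂ) =>
    (⟨NormedSpace.exp (Q a y u) * u, residual_value_mem (hQ a y) u.2⟩ :
      Matrix.specialUnitaryGroup (Fin n) ℂ)) with hF
  have hFΦ : ∀ V, F (FlowExistence.flowMap hZ1 1 V) = V := by
    intro V
    apply coeConfig_injective
    rw [hF, coeConfig_sunResidualLayer p Q Qamb hQ hQambQ]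
    have h := residualIsotopy_flowMap_eq p Q Qamb hQ2 hQambQ hZ1 hZt hZ0 hZid 1 V
    have h1 : (1 - Real.cos (Real.pi * 1)) / 2 = (1 : ℝ) := by rw [mul_one, Real.cos_pi]; norm_num
    rwa [h1] at h
  -- measurability of the layer (it is continuous) and of the flow
  have hFcont : Continuous F := by
    have hF' : F = fun (U : GaugeConfig d L (Matrix.specialUnitaryGroup (Fin n) ℂ)) (e : Edge d L) =>
        if h : p e then (⟨NormedSpace.exp (Qamb ⟨e, h⟩ (coeConfig U)) * (U e : Matrix (Fin n) (Fin n) ℂ),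
          by
            have hm := residualIsotopy_mem p Q Qamb hQ hQambQ 1 U e
            simpa only [h, ↓reduceDIte, one_smul, coeConfig_apply] using hm⟩ :
            Matrix.specialUnitaryGroup (Fin n) ℂ)
        else U e := by
      funext U e
      by_cases he : p e
      · rw [hF, Theory2.coupleFun_apply_of_pos _ _ he]
        simp only [he, ↓reduceDIte]
        apply Subtype.ext
        change NormedSpace.exp (Q ⟨e, he⟩ (fun f => U f) (U e)) * (U e : Matrix (Fin n) (Fin n) ℂ) =
          NormedSpace.exp (Qamb ⟨e, he⟩ (coeConfig U)) * (U e : Matrix (Fin n) (Fin n) ℂ)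
        rw [hQambQ ⟨e, he⟩]
      · rw [hF, Theory2.coupleFun_apply_of_neg _ _ he]
        simp only [he, ↓reduceDIte]
    rw [hF']
    refine continuous_pi fun e => ?_
    by_cases he : p e
    · simp only [he, ↓reduceDIte]
      exact ((continuous_matrix_exp.comp ((hQ2 ⟨e, he⟩).continuous.comp continuous_coeConfig)).mul
        (continuous_subtype_val.comp (continuous_apply e))).subtype_mk _
    · simp only [he, ↓reduceDIte]
      exact continuous_apply e
  have hΦm : Measurable (FlowExistence.flowMap hZ1 1) :=
    ((FlowExistence.continuous_flowMap hZ1 hZt).comp (Continuous.prodMk_right (1 : ℝ))).measurable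
  refine ⟨q, hqc, hq0, ⟨hFcont.measurable, ENNReal.measurable_ofReal.comp hqc.measurable, ?_⟩⟩
  -- `F_* (q · ⊗Haar) = F_* ((Φ_1)_* ⊗Haar) = (F ∘ Φ_1)_* ⊗Haar = ⊗Haar`
  have hμ : (Measure.pi fun _ : Edge d L => haarProbability (Matrix.specialUnitaryGroup (Fin n) ℂ)) =
      trivialMeasure (Matrix.specialUnitaryGroup (Fin n) ℂ) d L := rfl
  rw [hμ, ← hmap, Measure.map_map hFcont.measurable hΦm]
  have hcomp : F ∘ FlowExistence.flowMap hZ1 1 = id := funext hFΦ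
  rw [hcomp, Measure.map_id]

/-- **The certified Jacobian is essentially unique.**  Two `HasJacobian` certificates for the SAME
measurable automorphism `F` of a σ-finite space agree `vol`-almost everywhere: so any closed-form
density for the layer (e.g. the engine's per-link determinant), if it is an exact Jacobian, agrees
a.e. with the `J` of `hasJacobian_sunResidualLayer`. -/
theorem HasJacobian.jac_ae_eq {Ω : Type*} [MeasurableSpace Ω] {vol : Measure Ω} [SigmaFinite vol]
    {F : Ω ≃ᵐ Ω} {J J' : Ω → ℝ≥0∞} (h : HasJacobian vol F J) (h' : HasJacobian vol F J') :
    J =ᵐ[vol] J' := by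
  have hm : ∀ K : Ω → ℝ≥0∞, HasJacobian vol F K → vol.withDensity K = Measure.map F.symm vol := by
    intro K hK
    calc vol.withDensity K = Measure.map F.symm (Measure.map F (vol.withDensity K)) := by
          rw [Measure.map_map F.symm.measurable F.measurable, F.symm_comp_self, Measure.map_id]
      _ = Measure.map F.symm vol := by rw [hK.map_eq]
  exact (withDensity_eq_iff_of_sigmaFinite h.measurable_jac.aemeasurable h'.measurable_jac.aemeasurable).1
    ((hm J h).trans (hm J' h').symm)

end Layer

end Summit.Ventures.LatticeQCDFlow.Exactness

end
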